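import Summits.CriticalPhenomena.PercolationContinuityZ3.Theorems.PercNearOneGluingNoHeavyLowerTailSahiCombTriWSandwich

/-!
# The CYLINDER LEMMA for sandwich certificates: a certificate for `P ⊆ 2^γ` lifts to the cylinder `P × 2 ⊆ 2^(Option γ)`

Support file of the one-cut programme (crux `NoHeavyLowerTail`, stmt-CriticalPhenomena-4575; TRI lane of cell `prim-masterthm`;
seat prim-lf-1 gen 40; the lemma is P5 gen 24's paper remark, memo `FROM-prim-masterthm-p5-g24-SANDWICH.md` §1(c)/§4(a)).
Continuation of `…SahiCombTriWSandwich` (`FiveUpSet.SandwichCert`, `FiveUpSet.triW_nonneg_of_sandwichCert`).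

The fibre cube with one extra coordinate is modelled as `Finset (Option γ)`; its points split into the LOWER copy `s.map some` and the UPPER
copy `insertNone s` of the points `s : Finset γ`, and complementation swaps the copies: `(s.map some)ᶜ = insertNone sᶜ`.  For a family `A` of
the big cube write `A₀ = optLo A = {s | s.map some ∈ A}` and `A₁ = optHi A = {s | insertNone s ∈ A}` (for an up-set `A`: up-sets with
`A₀ ⊆ A₁`), and for a test family `P` of the small cube let `optCyl P = {t | eraseNone t ∈ P}` be its cylinder.  Then (exact identities)

  `U_{cyl P}(A,B) = U_P(A₀,B₀) + U_P(A₁,B₁)`,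
  `L_{cyl P}(A,B) = L_P(A₁,B₀) + L_P(A₀,B₁) − [#(rP∩A₀∩B₀) + #(rP∩A₁∩B₁) − #(rP∩A₁∩B₀) − #(rP∩A₀∩B₁)] ≤ L_P(A₁,B₀) + L_P(A₀,B₁)`

(`uForm_optCyl`, `lForm_optCyl_eq`, `lForm_optCyl_le`), and for every non-negative combination `k` of products of MONOTONE one-family literals
`k(A₁,B₀) + k(A₀,B₁) ≤ k(A₀,B₀) + k(A₁,B₁)` (`litVal_supermod`).  Hence (**`FiveUpSet.sandwichCert_optCyl`**): if `k = Σ λ_j V_j ⊗ B_j` is a sandwich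
certificate for `P` (`c·L_P ≤ k ≤ c·U_P` on pairs of up-sets), then `k'(A,B) := k(A₀,B₀) + k(A₁,B₁)` — the same literals read on the two
sections, `2k` literal pairs — is a sandwich certificate for `optCyl P` with the same `c`; and so (**`FiveUpSet.triW_nonneg_optCyl_of_sandwichCert`**)
`0 ≤ triW (optCyl P) F G` for every index cube and all monotone families of up-sets of the big cube.  Iterating, certificates survive any
number of dummy coordinates: *certifiability depends only on the essential variables of `P`* — which is NOT a formality for `TriWIneq`
itself (the functional `triW` is not invariant under moving a dummy fibre coordinate to the index cube: the `Λ_xyz` term changes).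
Application (**`FiveUpSet.triW_nonneg_optCyl_fin_four`**, **`…_optCyl_optCyl_fin_four`**): with P5's `sandwichCert_fin_four` every cylinder
(one or two extra coordinates) over ANY up-set of `2^4` satisfies `TriWIneq` for every index cube — e.g. `K₂₂ × 2`, `K₂₂ × 2²`, the first
certified families in dimension 5 and 6 outside the saturated / relatively-saturated / threshold strata.
HONEST LABEL: complete proofs, std axioms; a structural closure property of the certificate METHOD plus its computational corollary;
`TriWIneq` itself stays OPEN. [this work; lemma statement due to P5 gen 24]
-/

namespace Summit.CriticalPhenomena.PercolationContinuityZ3.Theorems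

namespace FiveUpSet

open Finset

variable {β γ : Type} [DecidableEq β] [Fintype β] [DecidableEq γ] [Fintype γ]

/-! ### The two copies of `Finset γ` inside `Finset (Option γ)` and complementation -/

omit [Fintype β] [DecidableEq β] in
/-- Complement of a lower point: `(s.map some)ᶜ = insertNone sᶜ`. [this work] -/
theorem compl_map_some (s : Finset γ) : (s.map Function.Embedding.some)ᶜ = Finset.insertNone sᶜ := by
  ext o
  cases o with
  | none => simp
  | some a => simp

omit [Fintype β] [DecidableEq β] in
/-- Complement of an upper point: `(insertNone s)ᶜ = sᶜ.map some`. [this work] -/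
theorem compl_insertNone (s : Finset γ) : (Finset.insertNone s)ᶜ = sᶜ.map Function.Embedding.some := by
  ext o
  cases o with
  | none => simp
  | some a => simp

omit [Fintype β] [DecidableEq β] in
/-- `eraseNone` commutes with complementation. [this work] -/
theorem eraseNone_compl (t : Finset (Option γ)) : Finset.eraseNone tᶜ = (Finset.eraseNone t)ᶜ := by
  ext x
  simp [Finset.mem_eraseNone]

omit [Fintype β] [DecidableEq β] [Fintype γ] [DecidableEq γ] in
/-- The lower copy of `s` lies below its upper copy. [this work] -/
theorem map_some_subset_insertNone (s : Finset γ) : s.map Function.Embedding.some ⊆ Finset.insertNone s := by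
  intro o ho
  obtain ⟨a, ha, rfl⟩ := mem_map.1 ho
  simpa using ha

/-! ### Sections and the cylinder -/

/-- Lower section `A₀ = {s | s.map some ∈ A}` of a family of the big cube. [this work] -/
def optLo (A : Finset (Finset (Option γ))) : Finset (Finset γ) := univ.filter fun s => s.map Function.Embedding.some ∈ A

/-- Upper section `A₁ = {s | insertNone s ∈ A}` of a family of the big cube. [this work] -/
def optHi (A : Finset (Finset (Option γ))) : Finset (Finset γ) := univ.filter fun s => Finset.insertNone s ∈ A

/-- The cylinder `P × 2 = {t | eraseNone t ∈ P}` over a family `P` of the small cube. [this work] -/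
def optCyl (P : Finset (Finset γ)) : Finset (Finset (Option γ)) := univ.filter fun t => Finset.eraseNone t ∈ P

omit [Fintype β] [DecidableEq β] in
/-- Membership in the lower section. [this work] -/
@[simp] theorem mem_optLo {A : Finset (Finset (Option γ))} {s : Finset γ} : s ∈ optLo A ↔ s.map Function.Embedding.some ∈ A := by
  simp [optLo]

omit [Fintype β] [DecidableEq β] in
/-- Membership in the upper section. [this work] -/
@[simp] theorem mem_optHi {A : Finset (Finset (Option γ))} {s : Finset γ} : s ∈ optHi A ↔ Finset.insertNone s ∈ A := by
  simp [optHi]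

omit [Fintype β] [DecidableEq β] in
/-- Membership in the cylinder. [this work] -/
@[simp] theorem mem_optCyl {P : Finset (Finset γ)} {t : Finset (Option γ)} : t ∈ optCyl P ↔ Finset.eraseNone t ∈ P := by
  simp [optCyl]

omit [Fintype β] [DecidableEq β] in
/-- Sections commute with intersections. [this work] -/
theorem optLo_inter (A B : Finset (Finset (Option γ))) : optLo (A ∩ B) = optLo A ∩ optLo B := by
  ext s; simp [mem_inter]

omit [Fintype β] [DecidableEq β] in
/-- The upper section commutes with intersections. [this work] -/
theorem optHi_inter (A B : Finset (Finset (Option γ))) : optHi (A ∩ B) = optHi A ∩ optHi B := by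
  ext s; simp [mem_inter]

omit [Fintype β] [DecidableEq β] in
/-- Both sections of the cylinder over `P` are `P`. [this work] -/
@[simp] theorem optLo_optCyl (P : Finset (Finset γ)) : optLo (optCyl P) = P := by
  ext s; simp [Finset.eraseNone_map_some]

omit [Fintype β] [DecidableEq β] in
/-- The upper section of the cylinder over `P` is `P`. [this work] -/
@[simp] theorem optHi_optCyl (P : Finset (Finset γ)) : optHi (optCyl P) = P := by
  ext s; simp [Finset.eraseNone_insertNone]

omit [Fintype β] [DecidableEq β] in
/-- The antipodal image of a cylinder is the cylinder of the antipodal image. [this work] -/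
theorem refl_optCyl (P : Finset (Finset γ)) : refl (optCyl P) = optCyl (refl P) := by
  ext t
  rw [mem_refl, mem_optCyl, mem_optCyl, mem_refl, eraseNone_compl]

omit [Fintype β] [DecidableEq β] in
/-- The lower section of the antipodal image is the antipodal image of the UPPER section. [this work] -/
theorem optLo_refl (A : Finset (Finset (Option γ))) : optLo (refl A) = refl (optHi A) := by
  ext s
  rw [mem_optLo, mem_refl, compl_map_some, mem_refl, mem_optHi]

omit [Fintype β] [DecidableEq β] in
/-- The upper section of the antipodal image is the antipodal image of the LOWER section. [this work] -/
theorem optHi_refl (A : Finset (Finset (Option γ))) : optHi (refl A) = refl (optLo A) := by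
  ext s
  rw [mem_optHi, mem_refl, compl_insertNone, mem_refl, mem_optLo]

omit [Fintype β] [DecidableEq β] in
/-- **Counting through the sections**: `#X = #X₀ + #X₁`. [this work] -/
theorem card_eq_optLo_add_optHi (X : Finset (Finset (Option γ))) : X.card = (optLo X).card + (optHi X).card := by
  rw [← card_filter_add_card_filter_not (fun t : Finset (Option γ) => none ∉ t)]
  congr 1
  · symm
    refine card_bij' (fun s _ => s.map Function.Embedding.some) (fun t _ => Finset.eraseNone t) ?_ ?_ ?_ ?_
    · intro s hs
      rw [mem_filter]
      exact ⟨mem_optLo.1 hs, by simp⟩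
    · intro t ht
      rw [mem_filter] at ht
      rw [mem_optLo, Finset.map_some_eraseNone, erase_eq_of_notMem ht.2]
      exact ht.1
    · intro s _; exact Finset.eraseNone_map_some s
    · intro t ht
      rw [mem_filter] at ht
      rw [Finset.map_some_eraseNone, erase_eq_of_notMem ht.2]
  · symm
    refine card_bij' (fun s _ => Finset.insertNone s) (fun t _ => Finset.eraseNone t) ?_ ?_ ?_ ?_
    · intro s hs
      rw [mem_filter]
      exact ⟨mem_optHi.1 hs, by simp⟩
    · intro t ht
      rw [mem_filter, not_not] at ht
      rw [mem_optHi, Finset.insertNone_eraseNone, insert_eq_of_mem ht.2]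
      exact ht.1
    · intro s _; exact Finset.eraseNone_insertNone s
    · intro t ht
      rw [mem_filter, not_not] at ht
      rw [Finset.insertNone_eraseNone, insert_eq_of_mem ht.2]

omit [Fintype β] [DecidableEq β] in
/-- `#(cyl P ∩ A ∩ B) = #(P ∩ A₀ ∩ B₀) + #(P ∩ A₁ ∩ B₁)`. [this work] -/
theorem card_optCyl_inter_inter (P : Finset (Finset γ)) (A B : Finset (Finset (Option γ))) :
    (optCyl P ∩ A ∩ B).card = (P ∩ optLo A ∩ optLo B).card + (P ∩ optHi A ∩ optHi B).card := by
  rw [card_eq_optLo_add_optHi, optLo_inter, optLo_inter, optLo_optCyl, optHi_inter, optHi_inter, optHi_optCyl]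

/-! ### Up-sets -/

omit [Fintype β] [DecidableEq β] in
/-- The cylinder over an up-set is an up-set. [this work] -/
theorem isUpperSet_optCyl {P : Finset (Finset γ)} (hP : IsUpperSet (P : Set (Finset γ))) :
    IsUpperSet (optCyl P : Set (Finset (Option γ))) := by
  intro t t' htt ht
  rw [mem_coe, mem_optCyl] at ht ⊢
  exact hP (Finset.eraseNone.monotone htt) ht

omit [Fintype β] [DecidableEq β] in
/-- Sections of an up-set are up-sets. [this work] -/
theorem isUpperSet_optLo {A : Finset (Finset (Option γ))} (hA : IsUpperSet (A : Set (Finset (Option γ)))) :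
    IsUpperSet (optLo A : Set (Finset γ)) := by
  intro s s' hss hs
  rw [mem_coe, mem_optLo] at hs ⊢
  exact hA (map_subset_map.2 hss) hs

omit [Fintype β] [DecidableEq β] in
/-- The upper section of an up-set is an up-set. [this work] -/
theorem isUpperSet_optHi {A : Finset (Finset (Option γ))} (hA : IsUpperSet (A : Set (Finset (Option γ)))) :
    IsUpperSet (optHi A : Set (Finset γ)) := by
  intro s s' hss hs
  rw [mem_coe, mem_optHi] at hs ⊢
  exact hA (Finset.insertNone.monotone hss) hs

omit [Fintype β] [DecidableEq β] in
/-- For an up-set, the lower section is contained in the upper one. [this work] -/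
theorem optLo_subset_optHi {A : Finset (Finset (Option γ))} (hA : IsUpperSet (A : Set (Finset (Option γ)))) : optLo A ⊆ optHi A := by
  intro s hs
  rw [mem_optLo] at hs
  rw [mem_optHi]
  exact hA (map_some_subset_insertNone s) hs

/-! ### The two forms of the cylinder -/

omit [Fintype β] [DecidableEq β] in
/-- **`U_{cyl P}(A,B) = U_P(A₀,B₀) + U_P(A₁,B₁)`.** [this work] -/
theorem uForm_optCyl (P : Finset (Finset γ)) (A B : Finset (Finset (Option γ))) :
    uForm (optCyl P) A B = uForm P (optLo A) (optLo B) + uForm P (optHi A) (optHi B) := by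
  unfold uForm
  rw [refl_optCyl, card_optCyl_inter_inter, card_optCyl_inter_inter]
  push_cast
  ring

omit [Fintype β] [DecidableEq β] [Fintype γ] in
/-- Rearrangement: for nested `A₀ ⊆ A₁`, `B₀ ⊆ B₁` and any `S`, `#(S∩A₁∩B₀) + #(S∩A₀∩B₁) ≤ #(S∩A₀∩B₀) + #(S∩A₁∩B₁)`. [this work] -/
theorem card_cross_le_card_aligned (S A₀ A₁ B₀ B₁ : Finset (Finset γ)) (hA : A₀ ⊆ A₁) (hB : B₀ ⊆ B₁) :
    (S ∩ A₁ ∩ B₀).card + (S ∩ A₀ ∩ B₁).card ≤ (S ∩ A₀ ∩ B₀).card + (S ∩ A₁ ∩ B₁).card := by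
  have h := card_shell_inter_add S A₀ A₁ B₀ B₁ hA hB
  omega

omit [Fintype β] [DecidableEq β] in
/-- **The lower form of the cylinder, exactly**:
`L_{cyl P}(A,B) = L_P(A₁,B₀) + L_P(A₀,B₁) + [#(rP∩A₁∩B₀) + #(rP∩A₀∩B₁) − #(rP∩A₀∩B₀) − #(rP∩A₁∩B₁)]`. [this work] -/
theorem lForm_optCyl_eq (P : Finset (Finset γ)) (A B : Finset (Finset (Option γ))) :
    lForm (optCyl P) A B = lForm P (optHi A) (optLo B) + lForm P (optLo A) (optHi B)
      + ((((refl P ∩ optHi A ∩ optLo B).card : ℤ) + (refl P ∩ optLo A ∩ optHi B).card)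
          - (refl P ∩ optLo A ∩ optLo B).card - (refl P ∩ optHi A ∩ optHi B).card) := by
  unfold lForm
  rw [refl_optCyl, card_optCyl_inter_inter, card_optCyl_inter_inter, card_optCyl_inter_inter,
    optLo_refl, optHi_refl, optLo_refl, optHi_refl]
  push_cast
  ring

omit [Fintype β] [DecidableEq β] in
/-- **`L_{cyl P}(A,B) ≤ L_P(A₁,B₀) + L_P(A₀,B₁)`** whenever `A₀ ⊆ A₁`, `B₀ ⊆ B₁` (in particular for up-sets `A, B`). [this work] -/
theorem lForm_optCyl_le (P : Finset (Finset γ)) {A B : Finset (Finset (Option γ))} (hA : optLo A ⊆ optHi A) (hB : optLo B ⊆ optHi B) :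
    lForm (optCyl P) A B ≤ lForm P (optHi A) (optLo B) + lForm P (optLo A) (optHi B) := by
  rw [lForm_optCyl_eq]
  have h := card_cross_le_card_aligned (refl P) (optLo A) (optHi A) (optLo B) (optHi B) hA hB
  have h' : (((refl P ∩ optHi A ∩ optLo B).card : ℤ) + (refl P ∩ optLo A ∩ optHi B).card)
      ≤ (refl P ∩ optLo A ∩ optLo B).card + (refl P ∩ optHi A ∩ optHi B).card := by exact_mod_cast h
  linarith

/-! ### Lifting literals and certificates -/

/-- A literal read on the lower section. [this work] -/
def litLo (V : Finset (Finset γ) → Bool) : Finset (Finset (Option γ)) → Bool := fun A => V (optLo A)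

/-- A literal read on the upper section. [this work] -/
def litHi (V : Finset (Finset γ) → Bool) : Finset (Finset (Option γ)) → Bool := fun A => V (optHi A)

omit [Fintype β] [DecidableEq β] in
/-- A monotone literal read on the lower section is monotone. [this work] -/
theorem monoLit_litLo {V : Finset (Finset γ) → Bool} (hV : MonoLit V) : MonoLit (litLo V) := by
  intro A A' hAA h
  refine hV _ _ (fun s hs => ?_) h
  rw [mem_optLo] at hs ⊢
  exact hAA hs

omit [Fintype β] [DecidableEq β] in
/-- A monotone literal read on the upper section is monotone. [this work] -/
theorem monoLit_litHi {V : Finset (Finset γ) → Bool} (hV : MonoLit V) : MonoLit (litHi V) := by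
  intro A A' hAA h
  refine hV _ _ (fun s hs => ?_) h
  rw [mem_optHi] at hs ⊢
  exact hAA hs

/-- The lifted weights: the original weights twice. [this work] -/
def cylLam {k : ℕ} (lam : Fin k → ℕ) : Fin (k + k) → ℕ := Fin.append lam lam

/-- The lifted literal family: every literal read on the lower section, then every literal read on the upper section. [this work] -/
def cylLits {k : ℕ} (V : Fin k → (Finset (Finset γ) → Bool)) : Fin (k + k) → (Finset (Finset (Option γ)) → Bool) :=
  Fin.append (fun j => litLo (V j)) (fun j => litHi (V j))

omit [Fintype β] [DecidableEq β] in
/-- The lifted literal family consists of monotone literals. [this work] -/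
theorem monoLit_cylLits {k : ℕ} {V : Fin k → (Finset (Finset γ) → Bool)} (hV : ∀ j, MonoLit (V j)) (j : Fin (k + k)) :
    MonoLit (cylLits V j) := by
  unfold cylLits
  refine Fin.addCases (fun i => ?_) (fun i => ?_) j
  · rw [Fin.append_left]; exact monoLit_litLo (hV i)
  · rw [Fin.append_right]; exact monoLit_litHi (hV i)

omit [Fintype β] [DecidableEq β] in
/-- **The lifted form is the original form read on the two sections**: `k'(A,B) = k(A₀,B₀) + k(A₁,B₁)`. [this work] -/
theorem litVal_cyl {k : ℕ} (lam : Fin k → ℕ) (V B : Fin k → (Finset (Finset γ) → Bool)) (A Bs : Finset (Finset (Option γ))) :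
    litVal (cylLam lam) (cylLits V) (cylLits B) A Bs
      = litVal lam V B (optLo A) (optLo Bs) + litVal lam V B (optHi A) (optHi Bs) := by
  unfold litVal cylLam cylLits
  rw [Fin.sum_univ_add]
  simp only [Fin.append_left, Fin.append_right]
  rfl

omit [Fintype β] [DecidableEq β] [Fintype γ] [DecidableEq γ] in
/-- Supermodularity of a product of monotone literals across nested arguments:
`[V A₁][B B₀] + [V A₀][B B₁] ≤ [V A₀][B B₀] + [V A₁][B B₁]` for `A₀ ⊆ A₁`, `B₀ ⊆ B₁`. [this work] -/
theorem bInd_mul_supermod {δ : Type} [DecidableEq δ] [Fintype δ] {V B : Finset (Finset δ) → Bool} (hV : MonoLit V) (hB : MonoLit B)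
    {A₀ A₁ B₀ B₁ : Finset (Finset δ)} (hA : A₀ ⊆ A₁) (hBB : B₀ ⊆ B₁) :
    bInd V A₁ * bInd B B₀ + bInd V A₀ * bInd B B₁ ≤ bInd V A₀ * bInd B B₀ + bInd V A₁ * bInd B B₁ := by
  have h1 : V A₀ = true → V A₁ = true := hV _ _ hA
  have h2 : B B₀ = true → B B₁ = true := hB _ _ hBB
  unfold bInd
  cases hv0 : V A₀ <;> cases hv1 : V A₁ <;> cases hb0 : B B₀ <;> cases hb1 : B B₁ <;> simp_all

omit [Fintype β] [DecidableEq β] [Fintype γ] [DecidableEq γ] in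
/-- **Supermodularity of literal forms**: `k(A₁,B₀) + k(A₀,B₁) ≤ k(A₀,B₀) + k(A₁,B₁)` for `A₀ ⊆ A₁`, `B₀ ⊆ B₁` and monotone literals. [this work] -/
theorem litVal_supermod {δ : Type} [DecidableEq δ] [Fintype δ] {k : ℕ} (lam : Fin k → ℕ) {V B : Fin k → (Finset (Finset δ) → Bool)}
    (hV : ∀ j, MonoLit (V j)) (hB : ∀ j, MonoLit (B j)) {A₀ A₁ B₀ B₁ : Finset (Finset δ)} (hA : A₀ ⊆ A₁) (hBB : B₀ ⊆ B₁) :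
    litVal lam V B A₁ B₀ + litVal lam V B A₀ B₁ ≤ litVal lam V B A₀ B₀ + litVal lam V B A₁ B₁ := by
  unfold litVal
  rw [← sum_add_distrib, ← sum_add_distrib]
  refine sum_le_sum fun j _ => ?_
  have h := bInd_mul_supermod (hV j) (hB j) hA hBB
  have hl : (0 : ℤ) ≤ (lam j : ℤ) := by exact_mod_cast Nat.zero_le _
  nlinarith

/-- **THE CYLINDER LEMMA.**  A sandwich certificate for `P` lifts to a sandwich certificate for the cylinder `optCyl P` with the same `c`:
`k'(A,B) = k(A₀,B₀) + k(A₁,B₁)`.  Upper bound: `U_{cyl} = U(A₀,B₀) + U(A₁,B₁)`; lower bound: `L_{cyl} ≤ L(A₁,B₀) + L(A₀,B₁)` and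
supermodularity of `k`. [this work; statement P5 gen 24] -/
theorem sandwichCert_optCyl {P : Finset (Finset γ)} {c k : ℕ} {lam : Fin k → ℕ} {V B : Fin k → (Finset (Finset γ) → Bool)}
    (hV : ∀ j, MonoLit (V j)) (hB : ∀ j, MonoLit (B j)) (hcert : SandwichCert P c lam V B) :
    SandwichCert (optCyl P) c (cylLam lam) (cylLits V) (cylLits B) := by
  intro A Bs hA hBs
  have hA0 := isUpperSet_optLo hA
  have hA1 := isUpperSet_optHi hA
  have hB0 := isUpperSet_optLo hBs
  have hB1 := isUpperSet_optHi hBs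
  have hAA := optLo_subset_optHi hA
  have hBB := optLo_subset_optHi hBs
  rw [litVal_cyl]
  refine ⟨?_, ?_⟩
  · -- lower bound
    have hL := lForm_optCyl_le P hAA hBB
    have h10 := (hcert (optHi A) (optLo Bs) hA1 hB0).1
    have h01 := (hcert (optLo A) (optHi Bs) hA0 hB1).1
    have hsm := litVal_supermod lam hV hB hAA hBB
    have hc : (0 : ℤ) ≤ (c : ℤ) := by exact_mod_cast Nat.zero_le _
    nlinarith
  · -- upper bound
    have h00 := (hcert (optLo A) (optLo Bs) hA0 hB0).2
    have h11 := (hcert (optHi A) (optHi Bs) hA1 hB1).2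
    rw [uForm_optCyl, mul_add]
    exact add_le_add h00 h11

/-- **`TriWIneq` for cylinders of certified families.**  If `P` has a sandwich certificate with `c > 0` and monotone one-family literals,
then `0 ≤ triW (optCyl P) F G` for EVERY index cube `Finset β` and all monotone families `F, G` of up-sets of the big cube
`Finset (Option γ)`. [this work] -/
theorem triW_nonneg_optCyl_of_sandwichCert {P : Finset (Finset γ)} {c k : ℕ} {lam : Fin k → ℕ}
    {V B : Fin k → (Finset (Finset γ) → Bool)}
    (hc : 0 < c) (hV : ∀ j, MonoLit (V j)) (hB : ∀ j, MonoLit (B j)) (hcert : SandwichCert P c lam V B)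
    (F G : Finset β → Finset (Finset (Option γ)))
    (hF : ∀ x, IsUpperSet (F x : Set (Finset (Option γ)))) (hG : ∀ x, IsUpperSet (G x : Set (Finset (Option γ))))
    (hFm : Monotone F) (hGm : Monotone G) :
    0 ≤ triW (optCyl P) F G :=
  triW_nonneg_of_sandwichCert hc (monoLit_cylLits hV) (monoLit_cylLits hB) (sandwichCert_optCyl hV hB hcert) F G hF hG hFm hGm

end FiveUpSet

end Summit.CriticalPhenomena.PercolationContinuityZ3.Theorems
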